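import Mathlib.Algebra.Homology.DerivedCategory.Ext.ExactSequences
import Mathlib.Algebra.Homology.ShortComplex.Ab
import HarnessLib

/-!
# `Ext` computed from an acyclic resolution: `Extⁿ(X, M) ≅ Hⁿ(Ext⁰(X, I•))`

Topic `Algebra/Homology`; namespace `Literature.Algebra.Homology.AcyclicResolution`.  Pure homological
algebra in an arbitrary abelian category `C` with `HasExt` (Mathlib's derived-category `Abelian.Ext`),
no `sorry`, no named fact.

Let `X M : C` and let `0 → M —η→ I⁰ → I¹ → I² → ⋯` be an EXACT augmented cochain complex (`η` a
monomorphism with `M → I⁰ → I¹` exact, and `I` exact in every positive degree) whose terms are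
**acyclic for `Ext(X, –)`**: `Ext^{q+1}(X, Iⁿ) = 0` for all `n, q`.  Then for every `n`

  `Extⁿ(X, M) ≃+ Hⁿ( Ext⁰(X, I⁰) → Ext⁰(X, I¹) → Ext⁰(X, I²) → ⋯ )`,

the cohomology of the complex of abelian groups obtained by applying `Ext⁰(X, –) = Hom(X, –)` (Mathlib's
functor `Abelian.extFunctorObj X 0`) to `I`.  This is the standard "derived functors may be computed with
acyclic resolutions" statement (Weibel, *An introduction to homological algebra*, §2.4: dimension
shifting, Exercise 2.4.3, and dually the acyclic assembly of §2.7; Hartshorne III Prop. 1.2A), proved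
here by DIMENSION SHIFTING only, on top of Mathlib's long exact `Ext` sequences
(`Ext.covariant_sequence_exact₁/₃`): with `Zⁿ = ker dⁿ` (`I.cycles n`) the short exact sequences
`0 → Zⁿ → Iⁿ → Zⁿ⁺¹ → 0` give `Ext^{a}(X, Zⁿ⁺¹) ≅ Ext^{a+1}(X, Zⁿ)` (`a ≥ 1`) and
`Ext¹(X, Zⁿ) ≅ Ext⁰(X, Zⁿ⁺¹) / Im Ext⁰(X, Iⁿ)`, whence `Extⁿ⁺¹(X, M) ≅ Extⁿ⁺¹(X, Z⁰) ≅ … ≅ Ext¹(X, Zⁿ)`,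
and `Ext⁰(X, Zⁿ⁺¹) = ker(Ext⁰(X, Iⁿ⁺¹) → Ext⁰(X, Iⁿ⁺²))` by left exactness of `Hom`.

Written for Route A of the Poitou–Tate programme of crux `stmt-BirchSwinnertonDyer-19295` (cell
`bsd-schneider-ideate`, seat door-c4 gen 13): it is the engine behind the comparison
`Extⁿ_{C_Γ}(k, M) ≅ Hⁿ_cont(Γ, M)` between `Ext` in the category of discrete modules over a compact
group (Harari §4.3, files `DiscreteRep*`) and Mathlib's `continuousCohomology` (homogeneous continuous
cochains), Mathlib's standard complex `M → C(Γ, M) → C(Γ, C(Γ, M)) → ⋯` being an acyclic resolution.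

## What is here

* `extClass_postcomp_surjective / _injective`, **`shiftAddEquiv`**: dimension shifting along a short
  exact `S` with `Ext(X, S.X₂) = 0` in the two relevant degrees: `Ext^a(X, S.X₃) ≃+ Ext^{a+1}(X, S.X₁)`.
* `ker_extClass_postcomp_eq_range`, **`extOneQuotientAddEquiv`**:
  `Ext¹(X, S.X₁) ≃+ Ext⁰(X, S.X₃) ⧸ Im Ext⁰(X, S.X₂)` when `Ext¹(X, S.X₂) = 0`.
* `extAddEquivOfIso`: transport of `Ext X · n` along an isomorphism.
* `cyclesSC I n` = `0 → Zⁿ → Iⁿ → Zⁿ⁺¹ → 0` and its short exactness for `I` exact at `n + 1`;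
  `iterShift`: `Ext^{a+1}(X, Zⁿ) ≃+ Ext^{a+1+n}(X, Z⁰)`; `isoCyclesZero : M ≅ Z⁰`.
* `extComplex X I` (the complex `Ext⁰(X, I•)` of abelian groups), `cyclesExtAddEquiv`
  (`Ext⁰(X, Zʲ) ≃+ ker(Ext⁰(X, Iʲ) → Ext⁰(X, Iᵏ))`), and the main results
  **`extAddEquivHomologyZero : Ext⁰(X, M) ≃+ H⁰(extComplex X I)`** and
  **`extAddEquivHomologySucc : Extⁿ⁺¹(X, M) ≃+ Hⁿ⁺¹(extComplex X I)`**.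

Not here: naturality in `M` / in the resolution, compatibility with connecting homomorphisms.

## References
* C. A. Weibel, *An introduction to homological algebra*, CUP (1994), §2.4 (Exercise 2.4.3), §2.7. [Weibel1994]
* R. Hartshorne, *Algebraic Geometry*, GTM 52 (1977), III Proposition 1.2A. [Hartshorne1977]
-/

noncomputable section

universe w v u

namespace Literature.Algebra.Homology

namespace AcyclicResolution

open CategoryTheory CategoryTheory.Limits CategoryTheory.Abelian

variable {C : Type u} [Category.{v} C] [Abelian C] [HasExt.{w} C]

/-- Unfolding of Mathlib's `Ext.postcomp`: `β.postcomp X h x = x.comp β h`. [folklore] -/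
private theorem postcomp_apply (X : C) {Y Z : C} {n a b : ℕ} (β : Ext Y Z n) (h : a + n = b)
    (x : Ext X Y a) : β.postcomp X h x = x.comp β h := rfl

/-! ## §1 Dimension shifting along one short exact sequence -/

section Shift

variable (X : C) {S : ShortComplex C} (hS : S.ShortExact)

/-- If `Ext^b(X, S.X₂) = 0` then the connecting map `δ : Ext^a(X, S.X₃) → Ext^b(X, S.X₁)`
(`b = a + 1`) is surjective (exactness of `Ext^a(X, S.X₃) → Ext^b(X, S.X₁) → Ext^b(X, S.X₂)`).
[cite: Weibel1994, §2.4 (dimension shifting, Exercise 2.4.3)] -/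
theorem extClass_postcomp_surjective {a b : ℕ} (h : a + 1 = b)
    (hb : ∀ e : Ext X S.X₂ b, e = 0) :
    Function.Surjective (hS.extClass.postcomp X h) := by
  intro y
  obtain ⟨x, hx⟩ := Ext.covariant_sequence_exact₁ (X := X) (hS := hS) y (hb _) h
  exact ⟨x, hx⟩

/-- If `Ext^a(X, S.X₂) = 0` then the connecting map `δ : Ext^a(X, S.X₃) → Ext^b(X, S.X₁)`
(`b = a + 1`) is injective (exactness of `Ext^a(X, S.X₂) → Ext^a(X, S.X₃) → Ext^b(X, S.X₁)`).
[cite: Weibel1994, §2.4 (dimension shifting, Exercise 2.4.3)] -/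
theorem extClass_postcomp_injective {a b : ℕ} (h : a + 1 = b)
    (ha : ∀ e : Ext X S.X₂ a, e = 0) :
    Function.Injective (hS.extClass.postcomp X h) := by
  rw [injective_iff_map_eq_zero]
  intro x hx
  obtain ⟨y, rfl⟩ := Ext.covariant_sequence_exact₃ (X := X) (hS := hS) x h hx
  rw [ha y, Ext.zero_comp]

/-- **Dimension shifting.**  If `Ext^a(X, S.X₂) = 0 = Ext^b(X, S.X₂)` (`b = a + 1`) then the
connecting map is an isomorphism `Ext^a(X, S.X₃) ≃+ Ext^b(X, S.X₁)`.
[cite: Weibel1994, §2.4 (dimension shifting, Exercise 2.4.3)] -/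
def shiftAddEquiv {a b : ℕ} (h : a + 1 = b) (ha : ∀ e : Ext X S.X₂ a, e = 0)
    (hb : ∀ e : Ext X S.X₂ b, e = 0) : Ext X S.X₃ a ≃+ Ext X S.X₁ b :=
  AddEquiv.ofBijective (hS.extClass.postcomp X h)
    ⟨extClass_postcomp_injective X hS h ha, extClass_postcomp_surjective X hS h hb⟩

/-- Formula: `shiftAddEquiv` is postcomposition with the class of `S`.
[cite: Weibel1994, §2.4 (dimension shifting, Exercise 2.4.3)] -/
@[simp]
theorem shiftAddEquiv_apply {a b : ℕ} (h : a + 1 = b) (ha : ∀ e : Ext X S.X₂ a, e = 0)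
    (hb : ∀ e : Ext X S.X₂ b, e = 0) (x : Ext X S.X₃ a) :
    shiftAddEquiv X hS h ha hb x = x.comp hS.extClass h := rfl

/-- The kernel of `δ : Ext⁰(X, S.X₃) → Ext¹(X, S.X₁)` is the image of `Ext⁰(X, S.X₂)`.
[cite: Weibel1994, §2.4 (dimension shifting, Exercise 2.4.3)] -/
theorem ker_extClass_postcomp_eq_range :
    (hS.extClass.postcomp X (zero_add 1)).ker =
      ((Ext.mk₀ S.g).postcomp X (add_zero 0)).range := by
  ext x
  simp only [AddMonoidHom.mem_ker, AddMonoidHom.mem_range, postcomp_apply]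
  constructor
  · intro hx
    exact Ext.covariant_sequence_exact₃ (X := X) (hS := hS) x (zero_add 1) hx
  · rintro ⟨y, rfl⟩
    rw [Ext.comp_assoc_of_second_deg_zero, hS.comp_extClass, Ext.comp_zero]

/-- **`Ext¹(X, S.X₁) ≃+ Ext⁰(X, S.X₃) ⧸ Im Ext⁰(X, S.X₂)`** when `Ext¹(X, S.X₂) = 0` (the bottom
of the dimension shift). [cite: Weibel1994, §2.4 (dimension shifting, Exercise 2.4.3)] -/
def extOneQuotientAddEquiv (h1 : ∀ e : Ext X S.X₂ 1, e = 0) :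
    Ext X S.X₁ 1 ≃+ Ext X S.X₃ 0 ⧸ ((Ext.mk₀ S.g).postcomp X (add_zero 0)).range :=
  ((QuotientAddGroup.quotientAddEquivOfEq (ker_extClass_postcomp_eq_range X hS)).symm.trans
    (QuotientAddGroup.quotientKerEquivOfSurjective _
      (extClass_postcomp_surjective X hS (zero_add 1) h1))).symm

/-- Formula: the inverse of `extOneQuotientAddEquiv` sends the class of `x : Ext⁰(X, S.X₃)` to
`δ x = x ∘ [S]`. [cite: Weibel1994, §2.4 (dimension shifting, Exercise 2.4.3)] -/
theorem extOneQuotientAddEquiv_symm_mk (h1 : ∀ e : Ext X S.X₂ 1, e = 0) (x : Ext X S.X₃ 0) :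
    (extOneQuotientAddEquiv X hS h1).symm (QuotientAddGroup.mk x) =
      x.comp hS.extClass (zero_add 1) := rfl

end Shift

/-! ## §2 Transport of `Ext` along an isomorphism of the second variable -/

/-- `Ext X · n` transported along an isomorphism `Y ≅ Y'` (Mathlib's functor `extFunctorObj X n`).
[cite: Weibel1994, §2.7] -/
def extAddEquivOfIso (X : C) {Y Y' : C} (e : Y ≅ Y') (n : ℕ) : Ext X Y n ≃+ Ext X Y' n :=
  ((extFunctorObj X n).mapIso e).addCommGroupIsoToAddEquiv

/-- Formula: `extAddEquivOfIso X e n x = x ∘ e.hom`. [cite: Weibel1994, §2.7] -/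
@[simp]
theorem extAddEquivOfIso_apply (X : C) {Y Y' : C} (e : Y ≅ Y') (n : ℕ) (x : Ext X Y n) :
    extAddEquivOfIso X e n x = x.comp (Ext.mk₀ e.hom) (add_zero n) := rfl

/-! ## §3 The short exact sequences `0 → Zⁿ → Iⁿ → Zⁿ⁺¹ → 0` of a cochain complex -/

section Cycles

variable (I : CochainComplex C ℕ)

omit [HasExt C] in
/-- `ι_{Zⁿ} ≫ (Iⁿ → Zⁿ⁺¹) = 0`. [cite: Weibel1994, §2.4 (dimension shifting, Exercise 2.4.3)] -/
theorem iCycles_toCycles (n : ℕ) : I.iCycles n ≫ I.toCycles n (n + 1) = 0 := by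
  rw [← cancel_mono (I.iCycles (n + 1)), Category.assoc, HomologicalComplex.toCycles_i, zero_comp,
    HomologicalComplex.iCycles_d]

/-- The short complex `Zⁿ —ι→ Iⁿ —d→ Zⁿ⁺¹` (`Zⁿ = I.cycles n`, the second map the corestriction of
`dⁿ`). [cite: Weibel1994, §2.4 (dimension shifting, Exercise 2.4.3)] -/
abbrev cyclesSC (n : ℕ) : ShortComplex C :=
  ShortComplex.mk (I.iCycles n) (I.toCycles n (n + 1)) (iCycles_toCycles I n)

omit [HasExt C] in
/-- `Zⁿ → Iⁿ → Zⁿ⁺¹` is exact (because `Zⁿ → Iⁿ → Iⁿ⁺¹` is, `Zⁿ` being the kernel of `dⁿ`, and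
`Zⁿ⁺¹ → Iⁿ⁺¹` is a monomorphism). [cite: Weibel1994, §2.4 (dimension shifting, Exercise 2.4.3)] -/
theorem cyclesSC_exact (n : ℕ) : (cyclesSC I n).Exact := by
  have h : (ShortComplex.mk (I.iCycles n) (I.d n (n + 1)) (by simp)).Exact :=
    ShortComplex.exact_of_f_is_kernel _ (I.cyclesIsKernel n (n + 1) (by simp))
  let φ : cyclesSC I n ⟶ ShortComplex.mk (I.iCycles n) (I.d n (n + 1)) (by simp) :=
    { τ₁ := 𝟙 (I.cycles n)
      τ₂ := 𝟙 (I.X n)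
      τ₃ := I.iCycles (n + 1)
      comm₁₂ := by simp
      comm₂₃ := by simp }
  haveI : Epi φ.τ₁ := inferInstanceAs (Epi (𝟙 (I.cycles n)))
  haveI : IsIso φ.τ₂ := inferInstanceAs (IsIso (𝟙 (I.X n)))
  haveI : Mono φ.τ₃ := inferInstanceAs (Mono (I.iCycles (n + 1)))
  exact (ShortComplex.exact_iff_of_epi_of_isIso_of_mono φ).2 h

omit [HasExt C] in
/-- If `I` is exact in degree `n + 1` then `Iⁿ → Zⁿ⁺¹` is an epimorphism.
[cite: Weibel1994, §2.4 (dimension shifting, Exercise 2.4.3)] -/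
theorem epi_toCycles_of_exactAt (n : ℕ) (h : I.ExactAt (n + 1)) : Epi (I.toCycles n (n + 1)) := by
  have hi : (ComplexShape.up ℕ).prev (n + 1) = n := CochainComplex.prev_nat_succ n
  have hk : (ComplexShape.up ℕ).next (n + 1) = n + 1 + 1 := CochainComplex.next ℕ (n + 1)
  rw [I.exactAt_iff' n (n + 1) (n + 1 + 1) hi hk] at h
  have h' : Epi (I.toCycles n (n + 1) ≫ (I.cyclesIsoSc' n (n + 1) (n + 1 + 1) hi hk).hom) := by
    rw [HomologicalComplex.toCycles_cyclesIsoSc'_hom]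
    exact h.epi_toCycles
  have h'' := epi_comp (I.toCycles n (n + 1) ≫ (I.cyclesIsoSc' n (n + 1) (n + 1 + 1) hi hk).hom)
    (I.cyclesIsoSc' n (n + 1) (n + 1 + 1) hi hk).inv
  rwa [Category.assoc, Iso.hom_inv_id, Category.comp_id] at h''

omit [HasExt C] in
/-- **`0 → Zⁿ → Iⁿ → Zⁿ⁺¹ → 0` is short exact** when `I` is exact in degree `n + 1`.
[cite: Weibel1994, §2.4 (dimension shifting, Exercise 2.4.3)] -/
theorem cyclesSC_shortExact (n : ℕ) (h : I.ExactAt (n + 1)) : (cyclesSC I n).ShortExact :=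
  haveI := epi_toCycles_of_exactAt I n h
  ShortComplex.ShortExact.mk' (cyclesSC_exact I n) (inferInstanceAs (Mono (I.iCycles n))) this

variable (X : C)

/-- **Iterated dimension shifting**: for an exact complex with `Ext(X, –)`-acyclic terms,
`Ext^{a+1}(X, Zⁿ) ≃+ Ext^{a+1+n}(X, Z⁰)`. [cite: Weibel1994, §2.4 (dimension shifting, Exercise 2.4.3)] -/
def iterShift (hI : ∀ n, I.ExactAt (n + 1)) (hX : ∀ n q (e : Ext X (I.X n) (q + 1)), e = 0) :
    (n : ℕ) → {a b : ℕ} → (a + 1 + n = b) → (Ext X (I.cycles n) (a + 1) ≃+ Ext X (I.cycles 0) b)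
  | 0, _, _, h => by subst h; exact AddEquiv.refl _
  | n + 1, a, _, h =>
    (shiftAddEquiv X (cyclesSC_shortExact I n (hI n)) (rfl : a + 1 + 1 = a + 1 + 1) (hX n a)
      (hX n (a + 1))).trans (iterShift hI hX n (a := a + 1) (by omega))

variable {M : C} (η : M ⟶ I.X 0) (hη : η ≫ I.d 0 1 = 0)

omit [HasExt C] in
/-- For an exact augmentation `0 → M —η→ I⁰ → I¹` (`η` mono and `M → I⁰ → I¹` exact), `M ≅ Z⁰`
(Mathlib's `CochainComplex.isIso_liftCycles_iff`). [cite: Weibel1994, §2.4 (dimension shifting, Exercise 2.4.3)] -/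
def isoCyclesZero (hex : (ShortComplex.mk η (I.d 0 1) hη).Exact) [Mono η] : M ≅ I.cycles 0 :=
  haveI := (CochainComplex.isIso_liftCycles_iff I η hη).2 ⟨hex, inferInstance⟩
  asIso (I.liftCycles η 1 (CochainComplex.next ℕ 0) hη)

omit [HasExt C] in
/-- `(isoCyclesZero …).hom ≫ ι_{Z⁰} = η`. [cite: Weibel1994, §2.4 (dimension shifting, Exercise 2.4.3)] -/
@[simp]
theorem isoCyclesZero_hom_iCycles (hex : (ShortComplex.mk η (I.d 0 1) hη).Exact) [Mono η] :
    (isoCyclesZero I η hη hex).hom ≫ I.iCycles 0 = η := by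
  simp [isoCyclesZero]

end Cycles

/-! ## §4 The complex `Ext⁰(X, I•)` and its cycles -/

/-- Mathlib's functor `Y ↦ Ext X Y n` is additive. [cite: Weibel1994, §2.7] -/
instance extFunctorObj_additive (X : C) (n : ℕ) : (extFunctorObj.{w} X n).Additive where
  map_add {Y Z f g} := by
    ext x
    change (Ext.mk₀ (f + g)).postcomp X (add_zero n) x =
      (Ext.mk₀ f).postcomp X (add_zero n) x + (Ext.mk₀ g).postcomp X (add_zero n) x
    simp only [postcomp_apply, Ext.mk₀_add, Ext.comp_add]

variable (X : C) (I : CochainComplex C ℕ)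

/-- **The complex `Ext⁰(X, I⁰) → Ext⁰(X, I¹) → ⋯` of abelian groups** (`Ext⁰ = Hom`; Mathlib's
`extFunctorObj X 0` applied termwise). [cite: Weibel1994, §2.4 (dimension shifting, Exercise 2.4.3)] -/
abbrev extComplex : CochainComplex AddCommGrpCat.{w} ℕ :=
  ((extFunctorObj.{w} X 0).mapHomologicalComplex (ComplexShape.up ℕ)).obj I

/-- The differential of `extComplex X I` is postcomposition with the differential of `I`.
[cite: Weibel1994, §2.4 (dimension shifting, Exercise 2.4.3)] -/
@[simp]
theorem extComplex_d_apply (i j : ℕ) (x : Ext X (I.X i) 0) :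
    ((extComplex X I).d i j).hom x = x.comp (Ext.mk₀ (I.d i j)) (add_zero 0) := rfl

/-- The second map of the window `(extComplex X I).sc' i j k` applied to an element.
[cite: Weibel1994, §2.4 (dimension shifting, Exercise 2.4.3)] -/
@[simp]
theorem extComplex_sc'_g_apply (i j k : ℕ) (x : Ext X (I.X j) 0) :
    ((extComplex X I).sc' i j k).g.hom x = x.comp (Ext.mk₀ (I.d j k)) (add_zero 0) := rfl

/-- The first map of the window `(extComplex X I).sc' i j k` applied to an element.
[cite: Weibel1994, §2.4 (dimension shifting, Exercise 2.4.3)] -/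
@[simp]
theorem extComplex_sc'_f_apply (i j k : ℕ) (x : Ext X (I.X i) 0) :
    ((extComplex X I).sc' i j k).f.hom x = x.comp (Ext.mk₀ (I.d i j)) (add_zero 0) := rfl

/-- **Left exactness of `Hom`: `Ext⁰(X, Zʲ) ≃+ ker(Ext⁰(X, Iʲ) → Ext⁰(X, Iᵏ))`** (`k` the successor
of `j`), by `x ↦ x ∘ ι_{Zʲ}` (inverse: lifting to the kernel `Zʲ` of `dʲ`).
[cite: Weibel1994, §2.4 (dimension shifting, Exercise 2.4.3)] -/
def cyclesExtAddEquiv (i j k : ℕ) (hjk : (ComplexShape.up ℕ).next j = k) :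
    Ext X (I.cycles j) 0 ≃+ AddMonoidHom.ker ((extComplex X I).sc' i j k).g.hom :=
  AddEquiv.ofBijective
    (((Ext.mk₀ (I.iCycles j)).postcomp X (add_zero 0)).codRestrict _ (fun x => by
      show ((extComplex X I).sc' i j k).g.hom (x.comp (Ext.mk₀ (I.iCycles j)) (add_zero 0)) =
        (0 : Ext X (I.X k) 0)
      rw [extComplex_sc'_g_apply, Ext.comp_assoc_of_second_deg_zero, Ext.mk₀_comp_mk₀,
        HomologicalComplex.iCycles_d, Ext.mk₀_zero, Ext.comp_zero]))
    (by
      constructor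
      · intro x y hxy
        exact Ext.postcomp_mk₀_injective_of_mono X (I.iCycles j) (congrArg Subtype.val hxy)
      · rintro ⟨y, hy⟩
        change Ext X (I.X j) 0 at y
        have hy' : ((extComplex X I).sc' i j k).g.hom y = 0 := hy
        rw [extComplex_sc'_g_apply] at hy'
        have hy'' : Ext.addEquiv₀ y ≫ I.d j k = 0 := by
          apply Ext.addEquiv₀.symm.injective
          rw [Ext.addEquiv₀_symm_apply, Ext.addEquiv₀_symm_apply, ← Ext.mk₀_comp_mk₀,
            Ext.mk₀_addEquiv₀_apply, Ext.mk₀_zero]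
          exact hy'
        refine ⟨Ext.mk₀ (I.liftCycles (Ext.addEquiv₀ y) k hjk hy''), Subtype.ext ?_⟩
        change (Ext.mk₀ _).comp (Ext.mk₀ (I.iCycles j)) (add_zero 0) = y
        rw [Ext.mk₀_comp_mk₀, HomologicalComplex.liftCycles_i, Ext.mk₀_addEquiv₀_apply])

/-- Formula for `cyclesExtAddEquiv`. [cite: Weibel1994, §2.4 (dimension shifting, Exercise 2.4.3)] -/
theorem cyclesExtAddEquiv_apply_val (i j k : ℕ) (hjk : (ComplexShape.up ℕ).next j = k)
    (x : Ext X (I.cycles j) 0) :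
    (cyclesExtAddEquiv X I i j k hjk x).1 = x.comp (Ext.mk₀ (I.iCycles j)) (add_zero 0) :=
  rfl

/-- Under `cyclesExtAddEquiv`, the map `Ext⁰(X, Iⁿ) → Ext⁰(X, Zⁿ⁺¹)` becomes
`dⁿ_* : Ext⁰(X, Iⁿ) → ker(dⁿ⁺¹_*)` (Mathlib's `ShortComplex.abToCycles` of the degree-`(n, n+1, n+2)`
window of `extComplex X I`). [cite: Weibel1994, §2.4 (dimension shifting, Exercise 2.4.3)] -/
theorem cyclesExtAddEquiv_postcomp_toCycles (n : ℕ) (x : Ext X (I.X n) 0) :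
    cyclesExtAddEquiv X I n (n + 1) (n + 1 + 1) (CochainComplex.next ℕ (n + 1))
        ((Ext.mk₀ (I.toCycles n (n + 1))).postcomp X (add_zero 0) x) =
      ((extComplex X I).sc' n (n + 1) (n + 1 + 1)).abToCycles x := by
  apply Subtype.ext
  rw [cyclesExtAddEquiv_apply_val, ShortComplex.abToCycles_apply_coe]
  change _ = ((extComplex X I).sc' n (n + 1) (n + 1 + 1)).f.hom x
  rw [extComplex_sc'_f_apply, postcomp_apply, Ext.comp_assoc_of_second_deg_zero, Ext.mk₀_comp_mk₀,
    HomologicalComplex.toCycles_i]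

/-- Hence the image of `Ext⁰(X, Iⁿ) → Ext⁰(X, Zⁿ⁺¹)` corresponds to the image of `abToCycles`.
[cite: Weibel1994, §2.4 (dimension shifting, Exercise 2.4.3)] -/
theorem map_cyclesExtAddEquiv_range (n : ℕ) :
    AddSubgroup.map (cyclesExtAddEquiv X I n (n + 1) (n + 1 + 1) (CochainComplex.next ℕ (n + 1)))
        ((Ext.mk₀ (I.toCycles n (n + 1))).postcomp X (add_zero 0)).range =
      ((extComplex X I).sc' n (n + 1) (n + 1 + 1)).abToCycles.range := by
  rw [AddMonoidHom.map_range]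
  ext y
  constructor
  · rintro ⟨x, rfl⟩
    exact ⟨x, (cyclesExtAddEquiv_postcomp_toCycles X I n x).symm⟩
  · rintro ⟨x, rfl⟩
    exact ⟨x, cyclesExtAddEquiv_postcomp_toCycles X I n x⟩

/-- In the window `(0, 0, 1)` the incoming map is `d₀₀ = 0`, so `abToCycles` has trivial image.
[cite: Weibel1994, §2.4 (dimension shifting, Exercise 2.4.3)] -/
theorem abToCycles_zero_range_eq_bot :
    ((extComplex X I).sc' 0 0 1).abToCycles.range = ⊥ := by
  rw [eq_bot_iff]
  rintro _ ⟨x, rfl⟩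
  rw [AddSubgroup.mem_bot, Subtype.ext_iff, ShortComplex.abToCycles_apply_coe]
  change ((extComplex X I).sc' 0 0 1).f.hom x = (0 : Ext X (I.X 0) 0)
  rw [extComplex_sc'_f_apply, I.shape 0 0 (by simp), Ext.mk₀_zero, Ext.comp_zero]

/-! ## §5 Main results: `Extⁿ(X, M) ≃+ Hⁿ(Ext⁰(X, I•))` -/

variable {M : C} (η : M ⟶ I.X 0) (hη : η ≫ I.d 0 1 = 0)
  (hex : (ShortComplex.mk η (I.d 0 1) hη).Exact)
  (hI : ∀ n, I.ExactAt (n + 1)) (hX : ∀ n q (e : Ext X (I.X n) (q + 1)), e = 0)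

/-- **`Ext⁰(X, M) ≃+ H⁰(Ext⁰(X, I•))`** for an exact augmented complex `0 → M —η→ I⁰ → I¹` (`η` a
monomorphism, `M → I⁰ → I¹` exact): `Ext⁰(X, M) ≅ Ext⁰(X, Z⁰) = ker(Ext⁰(X, I⁰) → Ext⁰(X, I¹)) = H⁰`.
(No acyclicity is needed in degree `0`.) [cite: Weibel1994, §2.4 (dimension shifting, Exercise 2.4.3)] -/
def extAddEquivHomologyZero [Mono η] :
    Ext X M 0 ≃+ ((extComplex X I).homology 0 : AddCommGrpCat.{w}) :=
  (extAddEquivOfIso X (isoCyclesZero I η hη hex) 0).trans <|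
    (cyclesExtAddEquiv X I 0 0 1 (CochainComplex.next ℕ 0)).trans <|
      QuotientAddGroup.quotientBot.symm.trans <|
        (QuotientAddGroup.quotientAddEquivOfEq (abToCycles_zero_range_eq_bot X I).symm).trans
          ((extComplex X I).homologyIsoSc' 0 0 1 CochainComplex.prev_nat_zero
              (CochainComplex.next ℕ 0) ≪≫
            ShortComplex.abHomologyIso _).addCommGroupIsoToAddEquiv.symm

/-- **`Extⁿ⁺¹(X, M) ≃+ Hⁿ⁺¹(Ext⁰(X, I•))`** for an EXACT augmented complex
`0 → M —η→ I⁰ → I¹ → ⋯` (`η` mono, `M → I⁰ → I¹` exact, `I` exact in all degrees `≥ 1`) with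
`Ext(X, –)`-ACYCLIC terms (`Ext^{q+1}(X, Iⁿ) = 0` for all `n, q`):
`Extⁿ⁺¹(X, M) ≅ Extⁿ⁺¹(X, Z⁰) ≅ Ext¹(X, Zⁿ) ≅ Ext⁰(X, Zⁿ⁺¹)/Im Ext⁰(X, Iⁿ) ≅ ker dⁿ⁺¹_* / Im dⁿ_*`.
[cite: Weibel1994, §2.4 (dimension shifting, Exercise 2.4.3)] -/
def extAddEquivHomologySucc [Mono η] (n : ℕ) :
    Ext X M (n + 1) ≃+ ((extComplex X I).homology (n + 1) : AddCommGrpCat.{w}) :=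
  (extAddEquivOfIso X (isoCyclesZero I η hη hex) (n + 1)).trans <|
    (iterShift I X hI hX n (a := 0) (b := n + 1) (by omega)).symm.trans <|
      (extOneQuotientAddEquiv X (cyclesSC_shortExact I n (hI n)) (hX n 0)).trans <|
        (QuotientAddGroup.congr _ _
            (cyclesExtAddEquiv X I n (n + 1) (n + 1 + 1) (CochainComplex.next ℕ (n + 1)))
            (map_cyclesExtAddEquiv_range X I n)).trans
          ((extComplex X I).homologyIsoSc' n (n + 1) (n + 1 + 1) (CochainComplex.prev_nat_succ n)
              (CochainComplex.next ℕ (n + 1)) ≪≫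
            ShortComplex.abHomologyIso _).addCommGroupIsoToAddEquiv.symm

end AcyclicResolution

end Literature.Algebra.Homology
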